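import Mathlib.Algebra.Order.Floor.Defs
import Mathlib.Algebra.BigOperators.Ring.Finset
import Mathlib.Algebra.Order.BigOperators.Group.Finset
import Mathlib.Data.Real.Basic
import Mathlib.Tactic.Linarith
import Mathlib.Tactic.Positivity
import Mathlib.Tactic.FieldSimp
import Mathlib.Tactic.Ring
import HarnessLib

/-!
# R-H ROUND-3 AXIS D2, seat D2-EXP-5 (abc-iut-rh2-L1 g14): the HEIGHT EXPONENT of the object class «ACROSS-PLACE NETTING» is `−1`
# — exact-cell model, closed form: `s·(C(s)/R(s)) ∈ [C_lo/Dem, 2B/Dem]` for every height scale `s ≥ 2B/Dem`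

PROOF-ONLY file (0 definitions, 0 `Prop` facts, no instance, no notation) of the abc-iut cell, rung LADDER-ABC:A2.RESCUE.H, answering the
round-3 AXIS D2 KEY `D2-EXP-5` (HOME/wake/KEY-abc-iut-rh2-L1-D2-EXP-5.md, desk file R/ROUND3/AXIS-CD-DESK.md §D2): «from the FINAL's item
(1)(d) law (credit conductor-type while T ∝ h, C/R ∝ h⁻¹) derive the across-place-netting class's recovered-fraction EXPONENT in h … typed
statement; kernel face where decidable». Reference values of record (D0121-FINAL-1200Z.md (1)(e) §3, HEIGHT-CROSSING-rh-kit-2.tsv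
ea357dfc8e98a80c): fitted exponent of `C/R` between 10⁶ and 10⁹ nats FREY133 −0.9994 · HEX79 −1.0001 · FREY482 −0.9991 (computed ≠ proved).
THIS FILE PROVES THE EXPONENT IS EXACTLY `−1` IN THE EXACT-CELL MODEL, with both constants in closed form.

THE MODEL (= the kernel's cell currency, by name). A finite set `S` of cells `c` (in the setting: `c = (label j, place w)`), each with a
weight `ω_c ≥ 0` (procession normalisation `1/l⋆` × `Pr(w)·log p_w/e_w`), a DEMAND COEFFICIENT `A_c ≥ 0` (`= (j²−1)·m_q(w)`, the q-depth
`m_q(w) = ord_w(q^{1/2l})` — abc-iut-rh2-w-1 p476759 `RH.CellWeights.totalMass_eq_closedForm`: `M = PN Σ (j²−1)·|qLocal|`), a PRICE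
`P_c ≥ 0` (`= j·D_w + (j+1)·G_w`, different exponent `D_w`, log-shell span `G_w = R_in − R_out ≥ 0`) and a floor band `r_c ≥ 0` (`= e_w − 1`),
and a real CELL MARGIN `μ_c(s)` at height scale `s ≥ 0` (`m_q ↦ s·m_q` at fixed places and `l`, item (1)(e)) satisfying the TWO-SIDED CELL LAW
  `−s·A_c + P_c ≤ μ_c(s) ≤ −s·A_c + P_c + r_c`.                                                                    (★)
§1 DISCHARGES (★) for the kernel's integer margin `marg = m − e·⌊(j²·m − j·D − (j+1)·R_in)/e⌋ − (j+1)·R_out` (abc-iut-rh-typ-4 p481438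
`RHCellSlackExact.cellSlack_settingPrVolSharp_eq` / `RHCellSlackExactOrders.cellSlack_diag_orders`: the cell slack IS `(log p/e)·marg`; abc-iut-rh2-T-1
p491053 `RHCreditShellBudget.margin_le_sharp` is the upper half of (★)) — `margin_label_ge` / `margin_label_le`, at ANY integer depth `m`
(so at `m = s·m_q` for every integer `s`, and (★) with real `s` is the same algebra for the engines' rational grids).
NETTED QUANTITIES: credit `C(s) := Σ_c ω_c·μ_c(s)⁺`, remainder (debt) `R(s) := Σ_c ω_c·μ_c(s)⁻`, demand slope `Dem := Σ_c ω_c·A_c` (= the total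
mass `M` at `s = 1`), price ceiling `B := Σ_c ω_c·(P_c + r_c)`, price floor `B_lo := Σ_c ω_c·P_c`, credit floor `C_lo := Σ_{c : A_c = 0} ω_c·P_c`
(the demand-free cells = the labels `j = 1`). The typed Corollary netted across labels AND places is `R ≤ C` (abc-iut-rh2-q2-eq p480491
`RH.SigmaLicence.statement_iff_signedRemainder_nonpos`: `Statement ↔ D ≤ 0`, `D = R_∅ − C`).

WHAT IS PROVED (namespace `Summit.ABC.IUTFork.Repair.RHNettingHeightExponent`; every theorem over arbitrary real data satisfying (★)):
* §2 `credit_le_priceCeiling` — `C(s) ≤ B` for every `s ≥ 0`: THE CREDIT IS HEIGHT-FREE (item (1)(d), now for the whole netted sum);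
  `credit_ge_creditFloor` — `C_lo ≤ C(s)`; `remainder_ge` / `remainder_le` — `s·Dem − B ≤ R(s) ≤ s·Dem`: THE DEBT IS HEIGHT-LINEAR;
  `credit_sub_remainder_eq` — `C(s) − R(s) = Σ ω_c·μ_c(s)` (the signed bill); CROSSING BRACKET `remainder_le_credit_of_le_priceFloor`
  (`s·Dem ≤ B_lo ⇒ R(s) ≤ C(s)`) and `credit_lt_remainder_of_priceCeiling_lt` (`B < s·Dem ⇒ C(s) < R(s)`): the netted Corollary holds up to
  `s = B_lo/Dem` and fails from `s = B/Dem` on — the sign pattern «+ − − − …» of item (1)(e) in closed form, crossing `s× ∈ [B_lo/Dem, B/Dem]`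
  (= «`s×R = Π/M` to leading order», `Π ∈ [B_lo, B]`).
* §3 THE EXPONENT: `ratio_le` — `B < s·Dem ⇒ C(s)/R(s) ≤ B/(s·Dem − B)`; **`scale_mul_ratio_le`** — `2B ≤ s·Dem ⇒ s·(C(s)/R(s)) ≤ 2B/Dem`;
  **`scale_mul_ratio_ge`** — `B < s·Dem ⇒ C_lo/Dem ≤ s·(C(s)/R(s))`; together **`scale_mul_ratio_mem_Icc`**: for every `s ≥ 2B/Dem`,
  `s·(C/R)(s) ∈ [C_lo/Dem, 2B/Dem]` — the recovered fraction of across-place netting is `Θ(s⁻¹)` with HEIGHT-FREE constants: EXPONENT `−1`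
  (`≤ −1` unconditionally; `= −1` exactly when `C_lo > 0`, i.e. some demand-free cell carries price); and in the desk's currency
  `financed_le_priceCeiling` — the mass financed by across-place netting `min(C(s), R(s)) ≤ B` at every height, so `f_X(h) = min(C,R)/T(h) ≤ B/T(h)`.
* §1 (integers) `margin_label_ge` / `margin_label_le` / `margin_label_one_ge` / `margin_label_one_le` (at `j = 1` the margin is
  `D + 2G + ((m − D − 2R_in) mod e) ∈ [D + 2G, D + 2G + e − 1]` — height-free both ways) and the cell consequences `posPart_margin_le`,
  `negPart_margin_ge`, `negPart_margin_le`.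
READING for the assembler (R/ROUND3/AXIS-D2-EXPONENT-TABLE.md): e_X = −1; c_X = lim s·(C/R) ∈ [C_lo, B]/Dem per unit scale, i.e. in log-height
`h = s·h(1)` nats `c_X = h(1)·C_∞/M(1)` with `C_∞ ∈ [C_lo, C_lo + Σ_{j=1} ω·(e−1)]` the asymptotic (label-1) credit and `M(1) = Dem` the tabulated
total mass; pre-asymptotically (`s < max_c P_c/A_c`) the credit still sheds its `j ≥ 2` cells, so the local exponent is `< −1` there and `−1` after.
HONEST FRAMING: real/integer arithmetic about OUR typed cell currency; the identification «model margin = kernel cell slack» is the cited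
theorems' (p481438 / p491488), not re-proved here; nothing here decides any cell at genuine data, asserts or denies [IUTchIII] Cor. 3.12 /
[IUTchIV] Thm. 1.10, or bears on abc; no side taken on any author; typed ≠ proved; computed ≠ proved. [claim: Mochizuki2012, status: disputed]
for every IUT locution. [cite: Mochizuki2012, IUTchIII Cor. 3.12 p. 173–175; IUTchIV Prop. 1.2 (i)(ii) p. 10, Thm. 1.10 p. 26–28]
[cite: DupuyHilado2025, §3.7, §4.9, §4.12]
-/

noncomputable section

open Finset

namespace Summit.ABC.IUTFork.Repair.RHNettingHeightExponent

/-! ## §1. The integer cell law (★) for the kernel's margin, at an arbitrary depth `m` -/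

/-- Floor bookkeeping: `X − (e − 1) ≤ e·⌊X/e⌋ ≤ X` for `e > 0`. [folklore] -/
theorem sub_le_mul_ediv_and_le {e : ℤ} (he : 0 < e) (X : ℤ) : X - (e - 1) ≤ e * (X / e) ∧ e * (X / e) ≤ X := by
  have h1 : e * (X / e) + X % e = X := Int.mul_ediv_add_emod X e
  have h2 : X % e < e := Int.emod_lt_of_pos X he
  have h3 : 0 ≤ X % e := Int.emod_nonneg X he.ne'
  constructor <;> linarith

/-- **Lower half of (★)**: at label `j` (`j+1` slots, Θ-depth `j²·m`, q-depth `m`) the integer margin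
`marg = m − e·⌊(j²m − jD − (j+1)R_in)/e⌋ − (j+1)R_out` is at least `−(j²−1)·m + j·D + (j+1)·(R_in − R_out)`. [folklore] -/
theorem margin_label_ge {e : ℤ} (he : 0 < e) (j m D Rin Rout : ℤ) :
    -((j ^ 2 - 1) * m) + j * D + (j + 1) * (Rin - Rout) ≤
      m - e * ((j ^ 2 * m - j * D - (j + 1) * Rin) / e) - (j + 1) * Rout := by
  have h := (sub_le_mul_ediv_and_le he (j ^ 2 * m - j * D - (j + 1) * Rin)).2
  linarith

/-- **Upper half of (★)** (= abc-iut-rh2-T-1's `RHCreditShellBudget.margin_le_sharp` at `n = j+1`, `M = j²m`): the margin is at most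
`−(j²−1)·m + j·D + (j+1)·(R_in − R_out) + (e − 1)`. [folklore] -/
theorem margin_label_le {e : ℤ} (he : 0 < e) (j m D Rin Rout : ℤ) :
    m - e * ((j ^ 2 * m - j * D - (j + 1) * Rin) / e) - (j + 1) * Rout ≤
      -((j ^ 2 - 1) * m) + j * D + (j + 1) * (Rin - Rout) + (e - 1) := by
  have h := (sub_le_mul_ediv_and_le he (j ^ 2 * m - j * D - (j + 1) * Rin)).1
  linarith

/-- **Label `j = 1` is demand-free and height-free from below**: `D + 2·(R_in − R_out) ≤ marg` at EVERY depth `m`. [folklore] -/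
theorem margin_label_one_ge {e : ℤ} (he : 0 < e) (m D Rin Rout : ℤ) :
    D + 2 * (Rin - Rout) ≤ m - e * ((1 ^ 2 * m - 1 * D - (1 + 1) * Rin) / e) - (1 + 1) * Rout := by
  have h := margin_label_ge he 1 m D Rin Rout
  linarith

/-- **… and from above**: `marg ≤ D + 2·(R_in − R_out) + (e − 1)` at label `1`, every depth `m`. [folklore] -/
theorem margin_label_one_le {e : ℤ} (he : 0 < e) (m D Rin Rout : ℤ) :
    m - e * ((1 ^ 2 * m - 1 * D - (1 + 1) * Rin) / e) - (1 + 1) * Rout ≤ D + 2 * (Rin - Rout) + (e - 1) := by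
  have h := margin_label_le he 1 m D Rin Rout
  linarith

/-- **Cell credit is height-free**: for `j ≥ 1`, `m ≥ 0`, `D ≥ 0`, `R_out ≤ R_in`: `marg⁺ ≤ j·D + (j+1)·(R_in − R_out) + (e − 1)`. [folklore] -/
theorem posPart_margin_le {e : ℤ} (he : 0 < e) {j m D Rin Rout : ℤ} (hj : 1 ≤ j) (hm : 0 ≤ m) (hD : 0 ≤ D) (hG : Rout ≤ Rin) :
    max (m - e * ((j ^ 2 * m - j * D - (j + 1) * Rin) / e) - (j + 1) * Rout) 0 ≤ j * D + (j + 1) * (Rin - Rout) + (e - 1) := by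
  have h := margin_label_le he j m D Rin Rout
  have hj2 : 0 ≤ j ^ 2 - 1 := by nlinarith
  have hA : 0 ≤ (j ^ 2 - 1) * m := mul_nonneg hj2 hm
  have hP1 : 0 ≤ j * D := mul_nonneg (by linarith) hD
  have hP2 : 0 ≤ (j + 1) * (Rin - Rout) := mul_nonneg (by linarith) (by linarith)
  refine max_le ?_ ?_ <;> linarith

/-- **Cell debt is at least demand minus price**: `(j²−1)·m − (j·D + (j+1)·(R_in − R_out) + (e − 1)) ≤ marg⁻`. [folklore] -/
theorem negPart_margin_ge {e : ℤ} (he : 0 < e) (j m D Rin Rout : ℤ) :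
    (j ^ 2 - 1) * m - (j * D + (j + 1) * (Rin - Rout) + (e - 1)) ≤
      max (-(m - e * ((j ^ 2 * m - j * D - (j + 1) * Rin) / e) - (j + 1) * Rout)) 0 := by
  have h := margin_label_le he j m D Rin Rout
  exact le_max_of_le_left (by linarith)

/-- **Cell debt never exceeds demand**: for `j ≥ 1`, `m ≥ 0`, `D ≥ 0`, `R_out ≤ R_in`: `marg⁻ ≤ (j²−1)·m`. [folklore] -/
theorem negPart_margin_le {e : ℤ} (he : 0 < e) {j m D Rin Rout : ℤ} (hj : 1 ≤ j) (hm : 0 ≤ m) (hD : 0 ≤ D) (hG : Rout ≤ Rin) :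
    max (-(m - e * ((j ^ 2 * m - j * D - (j + 1) * Rin) / e) - (j + 1) * Rout)) 0 ≤ (j ^ 2 - 1) * m := by
  have h := margin_label_ge he j m D Rin Rout
  have hj2 : 0 ≤ j ^ 2 - 1 := by nlinarith
  have hA : 0 ≤ (j ^ 2 - 1) * m := mul_nonneg hj2 hm
  have hP1 : 0 ≤ j * D := mul_nonneg (by linarith) hD
  have hP2 : 0 ≤ (j + 1) * (Rin - Rout) := mul_nonneg (by linarith) (by linarith)
  refine max_le ?_ hA
  linarith

/-! ## §2. Netted sums under the cell law (★): credit height-free, debt height-linear, crossing bracket -/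

section Netted

variable {ι : Type*} {S : Finset ι} {ω A P r μ : ι → ℝ} {s : ℝ}

/-- Pointwise: under (★) with `s·A_c ≥ 0`, `r_c`-band: `μ_c⁺ ≤ P_c + r_c` (needs `P_c + r_c ≥ 0`). [folklore] -/
theorem posPart_le_of_cellLaw {a p q x t : ℝ} (hx : x ≤ -(t * a) + p + q) (hta : 0 ≤ t * a) (hpq : 0 ≤ p + q) :
    max x 0 ≤ p + q :=
  max_le (by linarith) hpq

/-- Pointwise: under (★), `t·A_c − (P_c + r_c) ≤ μ_c⁻`. [folklore] -/
theorem sub_le_negPart_of_cellLaw {a p q x t : ℝ} (hx : x ≤ -(t * a) + p + q) : t * a - (p + q) ≤ max (-x) 0 :=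
  le_max_of_le_left (by linarith)

/-- Pointwise: under (★) with `P_c ≥ 0`, `t·A_c ≥ 0`: `μ_c⁻ ≤ t·A_c`. [folklore] -/
theorem negPart_le_of_cellLaw {a p x t : ℝ} (hx : -(t * a) + p ≤ x) (hp : 0 ≤ p) (hta : 0 ≤ t * a) : max (-x) 0 ≤ t * a :=
  max_le (by linarith) hta

/-- **THE CREDIT IS HEIGHT-FREE (item (1)(d) for the whole netted sum)**: under (★) cellwise on `S`, with `ω, A, P, r ≥ 0` and `s ≥ 0`,
`C(s) = Σ ω_c·μ_c(s)⁺ ≤ B = Σ ω_c·(P_c + r_c)` — different + log-shell + floor band, NO height term. [folklore] -/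
theorem credit_le_priceCeiling (hω : ∀ c ∈ S, 0 ≤ ω c) (hA : ∀ c ∈ S, 0 ≤ A c) (hP : ∀ c ∈ S, 0 ≤ P c) (hr : ∀ c ∈ S, 0 ≤ r c)
    (hs : 0 ≤ s) (hhi : ∀ c ∈ S, μ c ≤ -(s * A c) + P c + r c) :
    ∑ c ∈ S, ω c * max (μ c) 0 ≤ ∑ c ∈ S, ω c * (P c + r c) := by
  refine sum_le_sum fun c hc => mul_le_mul_of_nonneg_left ?_ (hω c hc)
  exact posPart_le_of_cellLaw (hhi c hc) (mul_nonneg hs (hA c hc)) (add_nonneg (hP c hc) (hr c hc))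

/-- **THE DEBT IS HEIGHT-LINEAR, lower half**: `s·Dem − B ≤ R(s) = Σ ω_c·μ_c(s)⁻`, `Dem = Σ ω_c·A_c`. [folklore] -/
theorem remainder_ge (hω : ∀ c ∈ S, 0 ≤ ω c) (hhi : ∀ c ∈ S, μ c ≤ -(s * A c) + P c + r c) :
    s * ∑ c ∈ S, ω c * A c - ∑ c ∈ S, ω c * (P c + r c) ≤ ∑ c ∈ S, ω c * max (-μ c) 0 := by
  rw [mul_sum, ← sum_sub_distrib]
  refine sum_le_sum fun c hc => ?_
  have h := sub_le_negPart_of_cellLaw (hhi c hc)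
  have hω' := hω c hc
  calc s * (ω c * A c) - ω c * (P c + r c) = ω c * (s * A c - (P c + r c)) := by ring
    _ ≤ ω c * max (-μ c) 0 := mul_le_mul_of_nonneg_left h hω'

/-- **… upper half**: `R(s) ≤ s·Dem` (a cell's debt never exceeds its demand). [folklore] -/
theorem remainder_le (hω : ∀ c ∈ S, 0 ≤ ω c) (hA : ∀ c ∈ S, 0 ≤ A c) (hP : ∀ c ∈ S, 0 ≤ P c) (hs : 0 ≤ s)
    (hlo : ∀ c ∈ S, -(s * A c) + P c ≤ μ c) :
    ∑ c ∈ S, ω c * max (-μ c) 0 ≤ s * ∑ c ∈ S, ω c * A c := by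
  rw [mul_sum]
  refine sum_le_sum fun c hc => ?_
  have h := negPart_le_of_cellLaw (hlo c hc) (hP c hc) (mul_nonneg hs (hA c hc))
  calc ω c * max (-μ c) 0 ≤ ω c * (s * A c) := mul_le_mul_of_nonneg_left h (hω c hc)
    _ = s * (ω c * A c) := by ring

/-- **THE CREDIT FLOOR**: the demand-free cells (`A_c = 0`: the labels `j = 1`) keep their price at every height —
`C_lo = Σ_{c ∈ S, A_c = 0} ω_c·P_c ≤ C(s)`. [folklore] -/
theorem credit_ge_creditFloor [DecidablePred fun c => A c = 0] (hω : ∀ c ∈ S, 0 ≤ ω c)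
    (hlo : ∀ c ∈ S, -(s * A c) + P c ≤ μ c) :
    ∑ c ∈ S.filter (fun c => A c = 0), ω c * P c ≤ ∑ c ∈ S, ω c * max (μ c) 0 := by
  have hsub : ∑ c ∈ S.filter (fun c => A c = 0), ω c * max (μ c) 0 ≤ ∑ c ∈ S, ω c * max (μ c) 0 :=
    sum_le_sum_of_subset_of_nonneg (filter_subset _ S) fun c hc _ => mul_nonneg (hω c hc) (le_max_right _ _)
  refine le_trans (sum_le_sum fun c hc => ?_) hsub
  rw [mem_filter] at hc
  have h := hlo c hc.1
  rw [hc.2, mul_zero, neg_zero, zero_add] at h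
  exact mul_le_mul_of_nonneg_left (le_trans h (le_max_left _ _)) (hω c hc.1)

/-- **The signed bill**: `C(s) − R(s) = Σ ω_c·μ_c(s)` (`x⁺ − x⁻ = x`); the netted Corollary `R ≤ C` is its sign (p480491 / p482070). [folklore] -/
theorem credit_sub_remainder_eq :
    ∑ c ∈ S, ω c * max (μ c) 0 - ∑ c ∈ S, ω c * max (-μ c) 0 = ∑ c ∈ S, ω c * μ c := by
  rw [← sum_sub_distrib]
  refine sum_congr rfl fun c _ => ?_
  have h : max (μ c) 0 - max (-μ c) 0 = μ c := by
    rcases le_total 0 (μ c) with h0 | h0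
    · rw [max_eq_left h0, max_eq_right (by linarith : -μ c ≤ 0)]; ring
    · rw [max_eq_right h0, max_eq_left (by linarith : 0 ≤ -μ c)]; ring
  rw [← mul_sub, h]

/-- **CROSSING BRACKET, low side**: while the scaled demand is below the price FLOOR, `s·Dem ≤ B_lo = Σ ω_c·P_c`, the netted Corollary holds:
`R(s) ≤ C(s)`. [folklore] -/
theorem remainder_le_credit_of_le_priceFloor (hω : ∀ c ∈ S, 0 ≤ ω c) (hlo : ∀ c ∈ S, -(s * A c) + P c ≤ μ c)
    (hsB : s * ∑ c ∈ S, ω c * A c ≤ ∑ c ∈ S, ω c * P c) :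
    ∑ c ∈ S, ω c * max (-μ c) 0 ≤ ∑ c ∈ S, ω c * max (μ c) 0 := by
  have hbill : 0 ≤ ∑ c ∈ S, ω c * μ c := by
    have h1 : ∑ c ∈ S, ω c * (-(s * A c) + P c) ≤ ∑ c ∈ S, ω c * μ c :=
      sum_le_sum fun c hc => mul_le_mul_of_nonneg_left (hlo c hc) (hω c hc)
    have h2 : ∑ c ∈ S, ω c * (-(s * A c) + P c) = ∑ c ∈ S, ω c * P c - s * ∑ c ∈ S, ω c * A c := by
      rw [mul_sum, ← sum_sub_distrib]
      exact sum_congr rfl fun c _ => by ring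
    linarith
  have h := (credit_sub_remainder_eq (S := S) (ω := ω) (μ := μ))
  linarith

/-- **CROSSING BRACKET, high side**: once the scaled demand exceeds the price CEILING, `B = Σ ω_c·(P_c + r_c) < s·Dem`, the netted
Corollary FAILS: `C(s) < R(s)`. So the crossing scale `s×` lies in `[B_lo/Dem, B/Dem]` («`s×R = Π/M` to leading order», item (1)(e)). [folklore] -/
theorem credit_lt_remainder_of_priceCeiling_lt (hω : ∀ c ∈ S, 0 ≤ ω c) (hhi : ∀ c ∈ S, μ c ≤ -(s * A c) + P c + r c)
    (hBs : ∑ c ∈ S, ω c * (P c + r c) < s * ∑ c ∈ S, ω c * A c) :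
    ∑ c ∈ S, ω c * max (μ c) 0 < ∑ c ∈ S, ω c * max (-μ c) 0 := by
  have hbill : ∑ c ∈ S, ω c * μ c ≤ ∑ c ∈ S, ω c * (P c + r c) - s * ∑ c ∈ S, ω c * A c := by
    have h1 : ∑ c ∈ S, ω c * μ c ≤ ∑ c ∈ S, ω c * (-(s * A c) + P c + r c) :=
      sum_le_sum fun c hc => mul_le_mul_of_nonneg_left (hhi c hc) (hω c hc)
    have h2 : ∑ c ∈ S, ω c * (-(s * A c) + P c + r c) = ∑ c ∈ S, ω c * (P c + r c) - s * ∑ c ∈ S, ω c * A c := by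
      rw [mul_sum, ← sum_sub_distrib]
      exact sum_congr rfl fun c _ => by ring
    linarith
  have h := (credit_sub_remainder_eq (S := S) (ω := ω) (μ := μ))
  linarith

/-- **Desk currency**: the mass financed by across-place netting, `min(C(s), R(s))`, never exceeds the height-free price ceiling `B`;
hence `f_X(h) = min(C, R)/T(h) ≤ B/T(h)` against any height-linear requirement `T(h)`. [folklore] -/
theorem financed_le_priceCeiling (hω : ∀ c ∈ S, 0 ≤ ω c) (hA : ∀ c ∈ S, 0 ≤ A c) (hP : ∀ c ∈ S, 0 ≤ P c) (hr : ∀ c ∈ S, 0 ≤ r c)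
    (hs : 0 ≤ s) (hhi : ∀ c ∈ S, μ c ≤ -(s * A c) + P c + r c) :
    min (∑ c ∈ S, ω c * max (μ c) 0) (∑ c ∈ S, ω c * max (-μ c) 0) ≤ ∑ c ∈ S, ω c * (P c + r c) :=
  le_trans (min_le_left _ _) (credit_le_priceCeiling hω hA hP hr hs hhi)

/-! ## §3. The exponent: `s·(C/R)(s)` is trapped between two height-free constants -/

/-- **Upper law**: `B < s·Dem ⇒ C(s)/R(s) ≤ B/(s·Dem − B)`. [folklore] -/
theorem ratio_le (hω : ∀ c ∈ S, 0 ≤ ω c) (hA : ∀ c ∈ S, 0 ≤ A c) (hP : ∀ c ∈ S, 0 ≤ P c) (hr : ∀ c ∈ S, 0 ≤ r c) (hs : 0 ≤ s)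
    (hlaw : ∀ c ∈ S, μ c ≤ -(s * A c) + P c + r c) (hBs : ∑ c ∈ S, ω c * (P c + r c) < s * ∑ c ∈ S, ω c * A c) :
    (∑ c ∈ S, ω c * max (μ c) 0) / (∑ c ∈ S, ω c * max (-μ c) 0) ≤
      (∑ c ∈ S, ω c * (P c + r c)) / (s * ∑ c ∈ S, ω c * A c - ∑ c ∈ S, ω c * (P c + r c)) := by
  have hC := credit_le_priceCeiling hω hA hP hr hs hlaw
  have hR := remainder_ge hω hlaw
  have hden : 0 < s * ∑ c ∈ S, ω c * A c - ∑ c ∈ S, ω c * (P c + r c) := by linarith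
  have hRpos : 0 < ∑ c ∈ S, ω c * max (-μ c) 0 := lt_of_lt_of_le hden hR
  have hCnn : 0 ≤ ∑ c ∈ S, ω c * max (μ c) 0 := sum_nonneg fun c hc => mul_nonneg (hω c hc) (le_max_right _ _)
  calc (∑ c ∈ S, ω c * max (μ c) 0) / (∑ c ∈ S, ω c * max (-μ c) 0)
      ≤ (∑ c ∈ S, ω c * (P c + r c)) / (∑ c ∈ S, ω c * max (-μ c) 0) := div_le_div_of_nonneg_right hC hRpos.le
    _ ≤ (∑ c ∈ S, ω c * (P c + r c)) / (s * ∑ c ∈ S, ω c * A c - ∑ c ∈ S, ω c * (P c + r c)) :=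
        div_le_div_of_nonneg_left (le_trans hCnn hC) hden hR

/-- **THE EXPONENT IS AT MOST `−1`**: for every height scale `s > 0` with `2B ≤ s·Dem` (and `Dem > 0`), `s·(C(s)/R(s)) ≤ 2B/Dem` — a
HEIGHT-FREE constant (conductor-type: different + log-shell + floor band, over the demand slope). [folklore] -/
theorem scale_mul_ratio_le (hω : ∀ c ∈ S, 0 ≤ ω c) (hA : ∀ c ∈ S, 0 ≤ A c) (hP : ∀ c ∈ S, 0 ≤ P c) (hr : ∀ c ∈ S, 0 ≤ r c) (hs : 0 < s)
    (hlaw : ∀ c ∈ S, μ c ≤ -(s * A c) + P c + r c) (hDem : 0 < ∑ c ∈ S, ω c * A c)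
    (h2B : 2 * ∑ c ∈ S, ω c * (P c + r c) ≤ s * ∑ c ∈ S, ω c * A c) :
    s * ((∑ c ∈ S, ω c * max (μ c) 0) / (∑ c ∈ S, ω c * max (-μ c) 0)) ≤
      2 * (∑ c ∈ S, ω c * (P c + r c)) / ∑ c ∈ S, ω c * A c := by
  set B := ∑ c ∈ S, ω c * (P c + r c) with hBdef
  set Dm := ∑ c ∈ S, ω c * A c with hDmdef
  have hBnn : 0 ≤ B := sum_nonneg fun c hc => mul_nonneg (hω c hc) (add_nonneg (hP c hc) (hr c hc))
  have hC : ∑ c ∈ S, ω c * max (μ c) 0 ≤ B := credit_le_priceCeiling hω hA hP hr hs.le hlaw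
  have hR : s * Dm - B ≤ ∑ c ∈ S, ω c * max (-μ c) 0 := remainder_ge hω hlaw
  have hsDm : 0 < s * Dm := mul_pos hs hDem
  have hhalf : s * Dm / 2 ≤ s * Dm - B := by linarith
  have hRpos : 0 < ∑ c ∈ S, ω c * max (-μ c) 0 := by linarith
  calc s * ((∑ c ∈ S, ω c * max (μ c) 0) / (∑ c ∈ S, ω c * max (-μ c) 0))
      ≤ s * (B / (s * Dm / 2)) := by
        refine mul_le_mul_of_nonneg_left ?_ hs.le
        calc (∑ c ∈ S, ω c * max (μ c) 0) / (∑ c ∈ S, ω c * max (-μ c) 0)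
            ≤ B / (∑ c ∈ S, ω c * max (-μ c) 0) := div_le_div_of_nonneg_right hC hRpos.le
          _ ≤ B / (s * Dm / 2) := div_le_div_of_nonneg_left hBnn (by linarith) (le_trans hhalf hR)
    _ = 2 * B / Dm := by
        field_simp

/-- **THE EXPONENT IS AT LEAST `−1` (two-sided law)**: for every height scale `s > 0` beyond the price ceiling (`B < s·Dem`),
`C_lo/Dem ≤ s·(C(s)/R(s))` — the demand-free cells' price over the demand slope, HEIGHT-FREE. [folklore] -/
theorem scale_mul_ratio_ge [DecidablePred fun c => A c = 0] (hω : ∀ c ∈ S, 0 ≤ ω c) (hA : ∀ c ∈ S, 0 ≤ A c)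
    (hP : ∀ c ∈ S, 0 ≤ P c) (hs : 0 < s)
    (hlo : ∀ c ∈ S, -(s * A c) + P c ≤ μ c) (hhi : ∀ c ∈ S, μ c ≤ -(s * A c) + P c + r c) (hDem : 0 < ∑ c ∈ S, ω c * A c)
    (hBs : ∑ c ∈ S, ω c * (P c + r c) < s * ∑ c ∈ S, ω c * A c) :
    (∑ c ∈ S.filter (fun c => A c = 0), ω c * P c) / (∑ c ∈ S, ω c * A c) ≤
      s * ((∑ c ∈ S, ω c * max (μ c) 0) / (∑ c ∈ S, ω c * max (-μ c) 0)) := by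
  set Dm := ∑ c ∈ S, ω c * A c with hDmdef
  set Clo := ∑ c ∈ S.filter (fun c => A c = 0), ω c * P c with hClodef
  have hClo : Clo ≤ ∑ c ∈ S, ω c * max (μ c) 0 := credit_ge_creditFloor hω hlo
  have hRle : ∑ c ∈ S, ω c * max (-μ c) 0 ≤ s * Dm := remainder_le hω hA hP hs.le hlo
  have hRge : s * Dm - ∑ c ∈ S, ω c * (P c + r c) ≤ ∑ c ∈ S, ω c * max (-μ c) 0 := remainder_ge hω hhi
  have hRpos : 0 < ∑ c ∈ S, ω c * max (-μ c) 0 := by linarith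
  have hsDm : 0 < s * Dm := mul_pos hs hDem
  have hClonn : 0 ≤ Clo :=
    sum_nonneg fun c hc => mul_nonneg (hω c (mem_filter.mp hc).1) (hP c (mem_filter.mp hc).1)
  calc Clo / Dm = s * (Clo / (s * Dm)) := by
        field_simp
    _ ≤ s * (Clo / ∑ c ∈ S, ω c * max (-μ c) 0) :=
        mul_le_mul_of_nonneg_left (div_le_div_of_nonneg_left hClonn hRpos hRle) hs.le
    _ ≤ s * ((∑ c ∈ S, ω c * max (μ c) 0) / ∑ c ∈ S, ω c * max (-μ c) 0) :=
        mul_le_mul_of_nonneg_left (div_le_div_of_nonneg_right hClo hRpos.le) hs.le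

/-- **EXPONENT `−1`, BOTH CONSTANTS IN CLOSED FORM.** Under the cell law (★) on `S` (`ω, A, P, r ≥ 0`, `Dem > 0`), for EVERY height scale
`s > 0` with `2B ≤ s·Dem`: `s·(C(s)/R(s)) ∈ [C_lo/Dem, 2B/Dem]`. The recovered fraction of across-place netting is `Θ(s⁻¹)` between two
height-free constants: exponent `≤ −1` always, `= −1` exactly when `C_lo > 0`. [folklore] -/
theorem scale_mul_ratio_mem_Icc [DecidablePred fun c => A c = 0] (hω : ∀ c ∈ S, 0 ≤ ω c) (hA : ∀ c ∈ S, 0 ≤ A c)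
    (hP : ∀ c ∈ S, 0 ≤ P c) (hr : ∀ c ∈ S, 0 ≤ r c) (hs : 0 < s)
    (hlo : ∀ c ∈ S, -(s * A c) + P c ≤ μ c) (hhi : ∀ c ∈ S, μ c ≤ -(s * A c) + P c + r c) (hDem : 0 < ∑ c ∈ S, ω c * A c)
    (h2B : 2 * ∑ c ∈ S, ω c * (P c + r c) ≤ s * ∑ c ∈ S, ω c * A c) :
    s * ((∑ c ∈ S, ω c * max (μ c) 0) / (∑ c ∈ S, ω c * max (-μ c) 0)) ∈
      Set.Icc ((∑ c ∈ S.filter (fun c => A c = 0), ω c * P c) / ∑ c ∈ S, ω c * A c)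
        (2 * (∑ c ∈ S, ω c * (P c + r c)) / ∑ c ∈ S, ω c * A c) := by
  have hBnn : 0 ≤ ∑ c ∈ S, ω c * (P c + r c) :=
    sum_nonneg fun c hc => mul_nonneg (hω c hc) (add_nonneg (hP c hc) (hr c hc))
  have hsDm : 0 < s * ∑ c ∈ S, ω c * A c := mul_pos hs hDem
  refine ⟨scale_mul_ratio_ge hω hA hP hs hlo hhi hDem (by linarith), scale_mul_ratio_le hω hA hP hr hs hhi hDem h2B⟩

end Netted

/-! ## §4. The kernel's integer margin satisfies (★): the explicit instance at depth `m = s·m_q` -/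

section Explicit

variable {ι : Type*} {S : Finset ι} {ω : ι → ℝ} {j mq D Rin Rout e : ι → ℤ} {s : ℤ}

/-- **(★) for the explicit margin, real form**: with `A_c = (j²−1)·m_q`, `P_c = j·D + (j+1)·(R_in − R_out)`, `r_c = e − 1` and the depth
`m = s·m_q`, the kernel's integer margin cast to `ℝ` obeys `−s·A + P ≤ marg ≤ −s·A + P + r`. [folklore] -/
theorem cellLaw_explicit (he : ∀ c ∈ S, 0 < e c) (c : ι) (hc : c ∈ S) :
    -((s : ℝ) * (((j c : ℝ) ^ 2 - 1) * mq c)) + ((j c : ℝ) * D c + ((j c : ℝ) + 1) * (Rin c - Rout c)) ≤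
        ((s * mq c - e c * ((j c ^ 2 * (s * mq c) - j c * D c - (j c + 1) * Rin c) / e c) - (j c + 1) * Rout c : ℤ) : ℝ) ∧
      ((s * mq c - e c * ((j c ^ 2 * (s * mq c) - j c * D c - (j c + 1) * Rin c) / e c) - (j c + 1) * Rout c : ℤ) : ℝ) ≤
        -((s : ℝ) * (((j c : ℝ) ^ 2 - 1) * mq c)) + ((j c : ℝ) * D c + ((j c : ℝ) + 1) * (Rin c - Rout c)) + ((e c : ℝ) - 1) := by
  have h1 := margin_label_ge (he c hc) (j c) (s * mq c) (D c) (Rin c) (Rout c)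
  have h2 := margin_label_le (he c hc) (j c) (s * mq c) (D c) (Rin c) (Rout c)
  have h1' := (Int.cast_le (R := ℝ)).mpr h1
  have h2' := (Int.cast_le (R := ℝ)).mpr h2
  push_cast at h1' h2' ⊢
  constructor <;> linarith

/-- **THE HEIGHT EXPONENT OF ACROSS-PLACE NETTING IN THE KERNEL'S INTEGER CELL CURRENCY.** For every finite cell set with weights `ω ≥ 0`,
labels `j ≥ 1`, q-depths `m_q ≥ 0`, different exponents `D ≥ 0`, radii `R_out ≤ R_in`, ramification `e ≥ 1`, positive demand slope
`Dem = Σ ω·(j²−1)·m_q`, and every INTEGER height scale `s ≥ 1` with `2B ≤ s·Dem` (`B = Σ ω·(jD + (j+1)(R_in−R_out) + e − 1)`):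
`s·(C(s)/R(s)) ∈ [C_lo/Dem, 2B/Dem]`, `C(s)`/`R(s)` the ω-weighted positive/negative parts of the margins at depth `s·m_q`, `C_lo = Σ_{(j²−1)m_q = 0} ω·P`.
[folklore] -/
theorem scale_mul_ratio_mem_Icc_explicit (hω : ∀ c ∈ S, 0 ≤ ω c) (hj : ∀ c ∈ S, 1 ≤ j c) (hmq : ∀ c ∈ S, 0 ≤ mq c)
    (hD : ∀ c ∈ S, 0 ≤ D c) (hG : ∀ c ∈ S, Rout c ≤ Rin c) (he : ∀ c ∈ S, 0 < e c) (hs : 0 < s)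
    (hDem : 0 < ∑ c ∈ S, ω c * (((j c : ℝ) ^ 2 - 1) * mq c))
    (h2B : 2 * ∑ c ∈ S, ω c * (((j c : ℝ) * D c + ((j c : ℝ) + 1) * (Rin c - Rout c)) + ((e c : ℝ) - 1)) ≤
      (s : ℝ) * ∑ c ∈ S, ω c * (((j c : ℝ) ^ 2 - 1) * mq c)) :
    (s : ℝ) * ((∑ c ∈ S, ω c *
        max (((s * mq c - e c * ((j c ^ 2 * (s * mq c) - j c * D c - (j c + 1) * Rin c) / e c) - (j c + 1) * Rout c : ℤ) : ℝ)) 0) /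
      (∑ c ∈ S, ω c *
        max (-(((s * mq c - e c * ((j c ^ 2 * (s * mq c) - j c * D c - (j c + 1) * Rin c) / e c) - (j c + 1) * Rout c : ℤ) : ℝ))) 0)) ∈
      Set.Icc
        ((∑ c ∈ S.filter (fun c => ((j c : ℝ) ^ 2 - 1) * mq c = 0), ω c * ((j c : ℝ) * D c + ((j c : ℝ) + 1) * (Rin c - Rout c))) /
          ∑ c ∈ S, ω c * (((j c : ℝ) ^ 2 - 1) * mq c))
        (2 * (∑ c ∈ S, ω c * (((j c : ℝ) * D c + ((j c : ℝ) + 1) * (Rin c - Rout c)) + ((e c : ℝ) - 1))) /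
          ∑ c ∈ S, ω c * (((j c : ℝ) ^ 2 - 1) * mq c)) := by
  classical
  have hA : ∀ c ∈ S, 0 ≤ ((j c : ℝ) ^ 2 - 1) * mq c := fun c hc => by
    have hj' : (1 : ℝ) ≤ j c := by exact_mod_cast hj c hc
    have hm' : (0 : ℝ) ≤ mq c := by exact_mod_cast hmq c hc
    exact mul_nonneg (by nlinarith) hm'
  have hP : ∀ c ∈ S, 0 ≤ (j c : ℝ) * D c + ((j c : ℝ) + 1) * (Rin c - Rout c) := fun c hc => by
    have hj' : (1 : ℝ) ≤ j c := by exact_mod_cast hj c hc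
    have hD' : (0 : ℝ) ≤ D c := by exact_mod_cast hD c hc
    have hG' : (Rout c : ℝ) ≤ Rin c := by exact_mod_cast hG c hc
    exact add_nonneg (mul_nonneg (by linarith) hD') (mul_nonneg (by linarith) (by linarith))
  have hr : ∀ c ∈ S, 0 ≤ (e c : ℝ) - 1 := fun c hc => by
    have : (1 : ℤ) ≤ e c := he c hc
    have h' : (1 : ℝ) ≤ e c := by exact_mod_cast this
    linarith
  have hs' : (0 : ℝ) < s := by exact_mod_cast hs
  exact scale_mul_ratio_mem_Icc hω hA hP hr hs' (fun c hc => (cellLaw_explicit he c hc).1) (fun c hc => (cellLaw_explicit he c hc).2)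
    hDem h2B

end Explicit


end Summit.ABC.IUTFork.Repair.RHNettingHeightExponent

end
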